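import Summits.QuantumFields.YangMills.Theorems.BalabanUVNodesK0RecordFormatNamesFluctRatioC
import Mathlib.Analysis.SpecialFunctions.Gaussian.FourierTransform

/-!
# K0ᴬ∕K0⁷ — THE COMPLEX-GAUSSIAN RATIO STABILITY BRICK (CGRS) for DEF-1's `gaussRatioC`: numerator, denominator floor, ratio and `R − 1` bounds
(◇ lens-1 g13 NODE v14 «N4-R ⟸ CGRS brick + four model faces»; generic, model-free, Mathlib-only; consumer = FE-2 of ⟨27930⟩ via N4-R of v13.2∕v13.3)

LANDING NOTE (porter ▶ PTC-1 g4, 2026-08-31; AUTHORSHIP = ◇ lens-1 g13 «cauchy-analytic», HOME file `nodeO-cover/LENS-1g13-ComplexGaussianRatio-v1.lean` sha16 db60d35763c9169f · 583 l. · 34 thm +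
2 def (CANDIDATE 1 of g13 — NODE v14 wall N4-R ⟸ «CGRS», the complex-Gaussian ratio stability brick for ★★ DEF-1's total carrier `gaussRatioC` of ✓p824829 `…K0RecordFormatNamesFluctRatioC`)): the
HOME file exceeds the gate's 400-line cap, so it is landed as THREE files by a MECHANICAL split at the §4∕§5 and §6∕§7 boundaries (generator `work/gen/build_split_cgr.py` of this seat; header
docblock, preamble, docstrings, statements and proofs BYTE-IDENTICAL; the only new lines are this paragraph, the chained `import`, and the closing `end`s):
`…Theorems/BalabanUVNodesK0AxComplexGaussianRatioBounds.lean` (PART A = header + §1 real∕imaginary parts (`quadFormR`, `gaussNormR`) + §2 numerator bound + §3 ratio bound from a floor + §4 the `R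
− 1` bound (layer 1)); `…Theorems/BalabanUVNodesK0AxComplexGaussianRatioFrame.lean` (PART B = header + `import …K0AxComplexGaussianRatioBounds` + §5 LAYER 2a congruence frame + §6 LAYER 2b
existence of a congruence frame); `…Theorems/BalabanUVNodesK0AxComplexGaussianRatio.lean` (PART C (◇'s basename; the finals) = header + `import …K0AxComplexGaussianRatioFrame` + §7 LAYER 2c
denominator (`gaussNormC_floor`) + §8 the assembled brick (`norm_gaussRatioC_le_exp_trace`, `gaussNormC_ne_zero`, `norm_gaussRatioC_sub_one_le_trace`)).  THIS FILE: PART A = header + §1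
real∕imaginary parts (`quadFormR`, `gaussNormR`) + §2 numerator bound + §3 ratio bound from a floor + §4 the `R − 1` bound (layer 1).  ◆ CRIT-1 g38's cut: «(b) CUT — ◇ CANDIDATE 1 (g13)
db60d35763c9169f · 583 l. · 34 thm · 2 def → GO VERBATIM `--supports stmt-QuantumFields-27930 --as helper` (definition lane because of the 2 defs); probe `g38/CGR_probe.lean` (file + 34
`#guard_msgs … #print axioms` std guards) rc 0 · 0 err · 0 warn · 0 sorry; J4 name-dedup 36 names × {Summits, Literature, HarnessLib} = 0; stmt-dedup: `quadFormR` no `def` twin (25 inline-sum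
hits), `gaussNormR` none, `Pᵀ * A * P = 1` ONE hit = `Summits/HubbardSuperconductivity/…/BalabanIRBirComplexStableXYFixedVolumeGauss.lean` :58 `birGauss_exists_congruence (hA : A.PosDef) (hB :
B.IsHermitian)` + :160 `birGauss_integral_ne_zero` — the SAME congruence-frame ∕ non-vanishing device in ANOTHER summit (not importable across Summits; no FQN clash) ⇒ rider R-i: cited HERE as the
in-tree precedent of layer 2's qualitative half; J1′: `gaussNormR`'s Bochner-junk `0` SAID (:79) and REMOVED where used (`gaussNormC_floor` delivers `0 < gaussNormR (Re M)` ∧ `Integrable …` under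
`(Re M).PosDef`), every regime hypothesis displayed; the floor inequality checked on paper: ‖gaussNormC‖∕gaussNormR = Π_j (1+σ_j²)^{−¼} ≥ Π_j e^{−σ_j²∕4} by `1 + u ≤ e^u`, Σσ_j² = tr(A⁻¹BA⁻¹B) in
any congruence frame — TRUE and SECOND ORDER in Im M; (R-a) `gaussNormC_ne_zero` makes DEF-1's `gaussRatioC` quotient genuine on {Re M ≻ 0}; SAME-WALL: located-A = a KERNEL-PROVED model-free
stability brick for the TOTAL carrier, located-B UNCHANGED = N4-R's model faces + N8b; NOT a tautology, SURVIVES priced S» (nodeO STATUS 2026-08-31T15:07:19Z) and «(1) RE-KEY — CGRS GO ONTO ▶'s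
SPLIT (INTENT-80): (A) 370ab4c5247b1ad5 · 251 · 11 thm + 2 def, (B) 6270cc2ca952ba59 · 258 · 13 thm, (C) 7ba7bf850559a672 · 210 · 10 thm (pre-stamp bytes + this paragraph), chain A → B → C each
behind its own dry-run ACCEPT; declcmp monolith vs A∕B∕C = 13 SAME · 0 DIFF ∕ 13 SAME · 0 DIFF ∕ 10 SAME · 0 DIFF, 0 ONLY-B, 13+13+10 = 36 = all decls» (2026-08-31T15:10:09Z); `--supports
stmt-QuantumFields-27930 --as helper` (NO `--workitem`).  HONEST (porter): Mathlib-only theorems about parametric Gaussian integrals over `ι → ℝ`; nothing of Bałaban asserted, ported, discharged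
or refuted; the four MODEL faces and the holomorphy half of N4-R are NOT here; `stub_FE`∕`stub_P0C` and the crux ⟨27930⟩ OPEN; K0⁷ 20541 ∕ K0ᴬ 27238 ∕ K1ᴬ ∕ K3ᴬ OPEN — NOTHING of them proved; NODE
O 0∕1; COUNT 8∕28 · K 1∕4 UNMOVED; finite 𝕋⁴ at fixed ε — NOT continuum ∕ OS ∕ Clay; the Yang–Mills mass gap is NOT proved by any of this.

[I] = [Balaban1987RG1], [II] = [Balaban1988RG2Cluster], [Br] = [Brydges1986Course].

WHAT.  For DEF-1's TOTAL carriers `gaussIntC χ M E`, `gaussNormC M`, `gaussRatioC χ M E` (✓p824829 `…K0RecordFormatNamesFluctRatioC`: a complex matrix `M` over a finite index type `ι`,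
evaluated at REAL points, Lebesgue reference measure) this file PROVES the absolute-value half of print's «the analytically continued expectation is holomorphic and bounded by
`e^{O(1)|X|}` on the polydisc `|s_□| ≤ e^{κ}`» ([II] (1.13)–(1.14) p.5; [Br] §3), as a MODEL-FREE brick with every regime hypothesis displayed:
* LAYER 1 (§1–§4, inequalities from a denominator floor): `norm_gaussIntegrand` — `‖χ(x)·exp(−½·quadC M x + E x)‖ = |χ x|·exp(−½·quadFormR (Re M) x + Re (E x))` (the imaginary parts
  cost NOTHING in modulus); ★ (ii) `norm_gaussIntC_le` — `0 ≤ χ ≤ 1`, `Re E ≤ η` on `{χ ≠ 0}` ⟹ `‖gaussIntC χ M E‖ ≤ e^{η}·gaussNormR (Re M)`; ★ (iii) `norm_gaussRatioC_le_exp` — plus a floor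
  `e^{−τ}·gaussNormR (Re M) ≤ ‖gaussNormC M‖` ⟹ `‖gaussRatioC χ M E‖ ≤ e^{η+τ}`; ★ (iv) `norm_gaussRatioC_sub_one_le` — plus `‖exp(E x) − 1‖ ≤ η₁` on `{χ ≠ 0}` and a Gaussian TAIL budget
  `∫(1−χ)e^{−½quadFormR} ≤ T·gaussNormR` ⟹ `‖gaussRatioC χ M E − 1‖ ≤ e^{τ}(η₁ + T)`.
* LAYER 2 (§5–§7, what `τ` IS): ★★ `gaussNormC_eq_of_frame` — in a congruence frame `P` (real, invertible) bringing `½·quadC M` to `Σ_j b_j w_j²`, `Re b_j > 0`: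
  `gaussNormC M = |det P|·Π_j (π∕b_j)^{½}` (Lebesgue measure under `toLin' P`, `Real.map_matrix_volume_pi_eq_smul_volume_pi`, + Mathlib's one-dimensional complex Gaussians
  `GaussianFourier.integral_cexp_neg_sum_mul_add`); ★★ `exists_congruenceFrame` — for real symmetric `A ≻ 0`, `B`: `∃ P σ, PᵀAP = 1 ∧ PᵀBP = diagonal σ` (spectral theorem twice, Mathlib's
  `eigenvectorUnitary`); `sum_sq_eq_trace_of_frame` — `Σ_j σ_j² = tr(A⁻¹BA⁻¹B)` (basis-free); ★★★ `norm_gaussNormC_frame` — `‖gaussNormC M‖ = |det P|·Π_j √(2π)∕(1+σ_j²)^{¼}` and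
  `gaussNormR (Re M) = |det P|·(√(2π))^{n}`; ★★★ `gaussNormC_floor` — for `Re M ≻ 0`, `Im M` symmetric: `gaussNormC M ≠ 0`, `0 < gaussNormR (Re M)`, the real Gaussian is integrable, and
  THE SECOND-ORDER FLOOR `exp(−¼·tr((Re M)⁻¹(Im M)(Re M)⁻¹(Im M)))·gaussNormR (Re M) ≤ ‖gaussNormC M‖` (`1 + u ≤ e^{u}`).
* ASSEMBLED (§8): ★★★ `norm_gaussRatioC_le_exp_trace` — `‖gaussRatioC χ M E‖ ≤ exp(η + ¼·tr((Re M)⁻¹(Im M)(Re M)⁻¹(Im M)))`; `gaussNormC_ne_zero`; `norm_gaussRatioC_sub_one_le_trace`.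
WHY THE COMPLEX NORMALISATION IS THE RIGHT CARRIER (design remark for DEF-1∕N1): the modulus of the numerator only sees `Re M`; the modulus of the complex normalisation is SMALLER than
the real one only by `Π(1+σ_j²)^{−¼} ≥ e^{−¼Σσ_j²}` — SECOND order in `Im M` — whereas a fixed real normalisation would pay the FIRST-order shift `det(A + Re δM)∕det A`.
CONSUMER (N4-R of ◇ v13.2∕v13.3, FE-2 of ⟨27930⟩): with `M := piecesFormC … (recordSWeight … s) ψ`, `χ := chiRem …`, the model owes FOUR faces in its own currency — (F-coer) `Re M(s,ψ) ≻ 0`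
on `cpoly(e^{κ₁}) × recordUc` (coercivity margin (E3)), (F-im) the Hilbert–Schmidt budget `tr((Re M)⁻¹(Im M)(Re M)⁻¹(Im M)) ≤ 4θ·|c|`, (F-int) `Re E ≤ η·|c|` on `supp χ`, (F-tail) the cut-off
tail budget `T` — and then `c_R := η + θ`; NONE of them is asserted here.

HONEST FRAMING.  Mathlib-only theorems about parametric Gaussian integrals over `ι → ℝ`; junk discipline ◆ (R-a) respected (layer 1 ASSUMES the regime where used, layer 2 PROVES
non-vanishing∕positivity∕integrability under `Re M ≻ 0`; no `def … : Prop` letter).  Nothing of Bałaban is asserted, ported or discharged; the four MODEL faces and the holomorphy half of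
N4-R are NOT here; `stub_FE`∕`stub_P0C` OPEN, ⟨27930⟩ OPEN; K0⁷∕K0ᴬ∕K1ᴬ∕K3ᴬ OPEN; NODE O 0∕1; finite `𝕋⁴_{L^K}` at fixed ε — NOT continuum∕OS; **the Yang–Mills mass gap (Clay) is NOT
proved by any of this.**  No `sorry`, `instance`, `notation`, `structure`, `private`; standard axioms.
-/

noncomputable section

open scoped BigOperators
open MeasureTheory Complex

namespace Summit.QuantumFields.YangMills.Theorems.K0AxComplexGaussianRatio

open Summit.QuantumFields.YangMills.Theorems.K0RecordFormatNames (quadC gaussIntC gaussNormC gaussRatioC)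

variable {ι : Type*} [Fintype ι]

/-! ## §1  The real and imaginary parts of the form at a real point -/

/-- **`quadFormR A x := Σ_i Σ_j x_i·A_ij·x_j`** — the REAL quadratic form of a real matrix. [cite: Balaban1987RG1, (2.12) p.268] -/
def quadFormR (A : Matrix ι ι ℝ) (x : ι → ℝ) : ℝ := ∑ i, ∑ j, x i * A i j * x j

/-- A real matrix cast to `ℂ` has the real form as its complex form. [cite: Balaban1987RG1, (2.12) p.268 (bookkeeping)] -/
theorem quadC_map_ofReal (A : Matrix ι ι ℝ) (x : ι → ℝ) :
    quadC (A.map ((↑) : ℝ → ℂ)) x = (quadFormR A x : ℂ) := by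
  unfold quadC quadFormR
  push_cast
  simp only [Matrix.map_apply]

/-- `Re (quadC M x) = quadFormR (Re M) x` at a real point. [cite: Balaban1988RG2Cluster, (1.9)–(1.10) p.4 (bookkeeping)] -/
theorem re_quadC (M : Matrix ι ι ℂ) (x : ι → ℝ) : (quadC M x).re = quadFormR (M.map Complex.re) x := by
  unfold quadC quadFormR
  rw [Complex.re_sum]
  refine Finset.sum_congr rfl fun i _ => ?_
  rw [Complex.re_sum]
  refine Finset.sum_congr rfl fun j _ => ?_
  rw [Complex.re_mul_ofReal, Complex.re_ofReal_mul, Matrix.map_apply]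

/-- `Im (quadC M x) = quadFormR (Im M) x` at a real point. [cite: Balaban1988RG2Cluster, (1.9)–(1.10) p.4 (bookkeeping)] -/
theorem im_quadC (M : Matrix ι ι ℂ) (x : ι → ℝ) : (quadC M x).im = quadFormR (M.map Complex.im) x := by
  unfold quadC quadFormR
  rw [Complex.im_sum]
  refine Finset.sum_congr rfl fun i _ => ?_
  rw [Complex.im_sum]
  refine Finset.sum_congr rfl fun j _ => ?_
  rw [Complex.im_mul_ofReal, Complex.im_ofReal_mul, Matrix.map_apply]

/-- **`gaussNormR A := ∫ x, exp(−½·quadFormR A x) dx`** — the REAL Gaussian normalisation of a real matrix (Bochner; junk `0` when not integrable — SAID; `= (2π)^{n∕2}(det A)^{−1∕2}` for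
`A ≻ 0`, layer 2). [cite: Balaban1987RG1, (2.12) p.268] -/
def gaussNormR (A : Matrix ι ι ℝ) : ℝ := ∫ x : ι → ℝ, Real.exp (-(1 / 2 : ℝ) * quadFormR A x)

/-- `0 ≤ gaussNormR A` (always). [cite: Balaban1987RG1, (2.12) p.268 (bookkeeping)] -/
theorem gaussNormR_nonneg (A : Matrix ι ι ℝ) : 0 ≤ gaussNormR A :=
  integral_nonneg fun _ => (Real.exp_pos _).le

/-- FACE: the complex normalisation of a REAL matrix is the real one, cast. [cite: Balaban1987RG1, (2.12) p.268 (bookkeeping)] -/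
theorem gaussNormC_map_ofReal (A : Matrix ι ι ℝ) : gaussNormC (A.map ((↑) : ℝ → ℂ)) = (gaussNormR A : ℂ) := by
  unfold gaussNormC gaussNormR
  rw [← integral_complex_ofReal]
  refine integral_congr_ae (Filter.Eventually.of_forall fun x => ?_)
  simp only [quadC_map_ofReal]
  push_cast
  ring_nf

/-- ★ **THE MODULUS OF THE INTEGRAND**: `‖χ(x)·exp(−½·quadC M x + E x)‖ = |χ x|·exp(−½·quadFormR (Re M) x + Re (E x))` — the imaginary part of the form and of the exponent cost nothing.
[cite: Balaban1988RG2Cluster, (1.13)–(1.14) p.5; Brydges1986Course, §3] -/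
theorem norm_gaussIntegrand (χ : (ι → ℝ) → ℝ) (M : Matrix ι ι ℂ) (E : (ι → ℝ) → ℂ) (x : ι → ℝ) :
    ‖(χ x : ℂ) * Complex.exp (-(1 / 2 : ℂ) * quadC M x + E x)‖
      = |χ x| * Real.exp (-(1 / 2 : ℝ) * quadFormR (M.map Complex.re) x + (E x).re) := by
  rw [norm_mul, Complex.norm_real, Real.norm_eq_abs, Complex.norm_exp]
  congr 2
  have h : (-(1 / 2 : ℂ)) = ((-(1 / 2 : ℝ) : ℝ) : ℂ) := by push_cast; ring
  rw [Complex.add_re, h, Complex.re_ofReal_mul, re_quadC]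

/-- The modulus of the normalisation's integrand. [cite: Balaban1987RG1, (2.12) p.268 (bookkeeping)] -/
theorem norm_gaussNormIntegrand (M : Matrix ι ι ℂ) (x : ι → ℝ) :
    ‖Complex.exp (-(1 / 2 : ℂ) * quadC M x)‖ = Real.exp (-(1 / 2 : ℝ) * quadFormR (M.map Complex.re) x) := by
  have h := norm_gaussIntegrand (fun _ => (1 : ℝ)) M (fun _ => 0) x
  simpa using h

/-! ## §2  (ii) the numerator bound -/

/-- ★ **(ii) NUMERATOR BOUND**: for a cut-off `0 ≤ χ ≤ 1`, an exponent with `Re E ≤ η` on `{χ ≠ 0}`, and `Re M` with integrable Gaussian,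
`‖gaussIntC χ M E‖ ≤ e^{η}·gaussNormR (Re M)`. (No measurability of `χ`, `E` needed: a non-integrable numerator is Bochner-`0`.)
[cite: Balaban1988RG2Cluster, (1.13)–(1.14) p.5; Brydges1986Course, §3] -/
theorem norm_gaussIntC_le (χ : (ι → ℝ) → ℝ) (M : Matrix ι ι ℂ) (E : (ι → ℝ) → ℂ) (η : ℝ)
    (hχ : ∀ x, 0 ≤ χ x ∧ χ x ≤ 1) (hE : ∀ x, χ x ≠ 0 → (E x).re ≤ η)
    (hint : Integrable (fun x : ι → ℝ => Real.exp (-(1 / 2 : ℝ) * quadFormR (M.map Complex.re) x))) :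
    ‖gaussIntC χ M E‖ ≤ Real.exp η * gaussNormR (M.map Complex.re) := by
  unfold gaussIntC gaussNormR
  rw [← integral_const_mul]
  refine norm_integral_le_of_norm_le (hint.const_mul _) (Filter.Eventually.of_forall fun x => ?_)
  rw [norm_gaussIntegrand]
  by_cases h0 : χ x = 0
  · rw [h0, abs_zero, zero_mul]
    positivity
  · have h1 : (E x).re ≤ η := hE x h0
    have habs : |χ x| ≤ 1 := abs_le.2 ⟨by linarith [(hχ x).1], (hχ x).2⟩
    calc |χ x| * Real.exp (-(1 / 2 : ℝ) * quadFormR (M.map Complex.re) x + (E x).re)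
        ≤ 1 * Real.exp (-(1 / 2 : ℝ) * quadFormR (M.map Complex.re) x + η) :=
          mul_le_mul habs (Real.exp_le_exp.2 (by linarith)) (Real.exp_pos _).le zero_le_one
      _ = Real.exp η * Real.exp (-(1 / 2 : ℝ) * quadFormR (M.map Complex.re) x) := by
          rw [one_mul, add_comm, Real.exp_add]

/-! ## §3  (iii) the ratio bound from a denominator floor -/

/-- ★ **(iii) RATIO BOUND**: under (ii)'s hypotheses, a POSITIVE real Gaussian of `Re M` and a DENOMINATOR FLOOR `e^{−τ}·gaussNormR (Re M) ≤ ‖gaussNormC M‖` (layer 2: `τ = ¼·tr(A⁻¹BA⁻¹B)`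
for `M = A + iB`, `A ≻ 0`), `‖gaussRatioC χ M E‖ ≤ e^{η + τ}` — N4-R's `|R_c(s,ψ)| ≤ e^{c_R|c|}` with `c_R|c| := η + τ`.
[cite: Balaban1988RG2Cluster, (1.13)–(1.14) p.5; Brydges1986Course, §3] -/
theorem norm_gaussRatioC_le_exp (χ : (ι → ℝ) → ℝ) (M : Matrix ι ι ℂ) (E : (ι → ℝ) → ℂ) (η τ : ℝ)
    (hχ : ∀ x, 0 ≤ χ x ∧ χ x ≤ 1) (hE : ∀ x, χ x ≠ 0 → (E x).re ≤ η)
    (hint : Integrable (fun x : ι → ℝ => Real.exp (-(1 / 2 : ℝ) * quadFormR (M.map Complex.re) x)))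
    (hpos : 0 < gaussNormR (M.map Complex.re))
    (hden : Real.exp (-τ) * gaussNormR (M.map Complex.re) ≤ ‖gaussNormC M‖) :
    ‖gaussRatioC χ M E‖ ≤ Real.exp (η + τ) := by
  have hD : 0 < ‖gaussNormC M‖ := lt_of_lt_of_le (by positivity) hden
  unfold gaussRatioC
  rw [norm_div, div_le_iff₀ hD]
  have hsplit : Real.exp η = Real.exp (η + τ) * Real.exp (-τ) := by
    rw [← Real.exp_add]; congr 1; ring
  calc ‖gaussIntC χ M E‖ ≤ Real.exp η * gaussNormR (M.map Complex.re) := norm_gaussIntC_le χ M E η hχ hE hint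
    _ = Real.exp (η + τ) * (Real.exp (-τ) * gaussNormR (M.map Complex.re)) := by rw [hsplit, mul_assoc]
    _ ≤ Real.exp (η + τ) * ‖gaussNormC M‖ := mul_le_mul_of_nonneg_left hden (Real.exp_pos _).le

/-- Under a denominator floor the normalisation is NON-ZERO (so the ratio is a genuine quotient, not junk). [cite: Balaban1987RG1, (2.12) p.268] -/
theorem gaussNormC_ne_zero_of_floor (M : Matrix ι ι ℂ) (τ : ℝ) (hpos : 0 < gaussNormR (M.map Complex.re))
    (hden : Real.exp (-τ) * gaussNormR (M.map Complex.re) ≤ ‖gaussNormC M‖) : gaussNormC M ≠ 0 := by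
  have hD : 0 < ‖gaussNormC M‖ := lt_of_lt_of_le (by positivity) hden
  exact norm_pos_iff.1 hD

/-! ## §4  (iv) the `R − 1` bound (the `|c| = 1` clause) -/

/-- ★ **(iv) `R − 1` BOUND**: under a denominator floor, `0 ≤ χ ≤ 1`, `‖exp(E x) − 1‖ ≤ η₁` on `{χ ≠ 0}`, INTEGRABILITY of the numerator's integrand (displayed — here the difference
of two integrals is taken, so junk must be excluded) and a TAIL BUDGET `∫ (1 − χ)·e^{−½quadFormR (Re M)} ≤ T·gaussNormR (Re M)` for the cut-off,
`‖gaussRatioC χ M E − 1‖ ≤ e^{τ}·(η₁ + T)`. [cite: Balaban1988RG2Cluster, (1.7)–(1.10) p.4; Balaban1987RG1, (2.9) p.266; Brydges1986Course, §3] -/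
theorem norm_gaussRatioC_sub_one_le (χ : (ι → ℝ) → ℝ) (M : Matrix ι ι ℂ) (E : (ι → ℝ) → ℂ) (η₁ τ T : ℝ)
    (hχ : ∀ x, 0 ≤ χ x ∧ χ x ≤ 1) (hη₁ : 0 ≤ η₁) (hE : ∀ x, χ x ≠ 0 → ‖Complex.exp (E x) - 1‖ ≤ η₁)
    (hnum : Integrable (fun x : ι → ℝ => (χ x : ℂ) * Complex.exp (-(1 / 2 : ℂ) * quadC M x + E x)))
    (hden_int : Integrable (fun x : ι → ℝ => Complex.exp (-(1 / 2 : ℂ) * quadC M x)))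
    (htail_int : Integrable (fun x : ι → ℝ => (1 - χ x) * Real.exp (-(1 / 2 : ℝ) * quadFormR (M.map Complex.re) x)))
    (htail : ∫ x : ι → ℝ, (1 - χ x) * Real.exp (-(1 / 2 : ℝ) * quadFormR (M.map Complex.re) x) ≤ T * gaussNormR (M.map Complex.re))
    (hpos : 0 < gaussNormR (M.map Complex.re))
    (hden : Real.exp (-τ) * gaussNormR (M.map Complex.re) ≤ ‖gaussNormC M‖) :
    ‖gaussRatioC χ M E - 1‖ ≤ Real.exp τ * (η₁ + T) := by
  have hD : 0 < ‖gaussNormC M‖ := lt_of_lt_of_le (by positivity) hden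
  have hD0 : gaussNormC M ≠ 0 := norm_pos_iff.1 hD
  -- the tail budget is non-negative because the tail integral is
  have hT : 0 ≤ T := by
    have h0 : 0 ≤ ∫ x : ι → ℝ, (1 - χ x) * Real.exp (-(1 / 2 : ℝ) * quadFormR (M.map Complex.re) x) :=
      integral_nonneg fun x => mul_nonneg (by linarith [(hχ x).2]) (Real.exp_pos _).le
    by_contra h
    have : T * gaussNormR (M.map Complex.re) < 0 := mul_neg_of_neg_of_pos (not_le.mp h) hpos
    linarith
  -- `R − 1 = (num − den) ∕ den`
  have hR : gaussRatioC χ M E - 1 = (gaussIntC χ M E - gaussNormC M) / gaussNormC M := by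
    unfold gaussRatioC; field_simp
  rw [hR, norm_div, div_le_iff₀ hD]
  -- `num − den = ∫ (χ e^{E} − 1)·e^{−½ quadC}`
  have hdiff : gaussIntC χ M E - gaussNormC M
      = ∫ x : ι → ℝ, ((χ x : ℂ) * Complex.exp (E x) - 1) * Complex.exp (-(1 / 2 : ℂ) * quadC M x) := by
    unfold gaussIntC gaussNormC
    rw [← integral_sub hnum hden_int]
    refine integral_congr_ae (Filter.Eventually.of_forall fun x => ?_)
    simp only [Complex.exp_add]
    ring
  rw [hdiff]
  -- pointwise bound by `(η₁ + (1 − χ))·e^{−½ quadFormR}`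
  have hpt : ∀ x : ι → ℝ, ‖((χ x : ℂ) * Complex.exp (E x) - 1) * Complex.exp (-(1 / 2 : ℂ) * quadC M x)‖
      ≤ η₁ * Real.exp (-(1 / 2 : ℝ) * quadFormR (M.map Complex.re) x)
        + (1 - χ x) * Real.exp (-(1 / 2 : ℝ) * quadFormR (M.map Complex.re) x) := by
    intro x
    rw [norm_mul, norm_gaussNormIntegrand, ← add_mul]
    refine mul_le_mul_of_nonneg_right ?_ (Real.exp_pos _).le
    have hsplit : (χ x : ℂ) * Complex.exp (E x) - 1 = (χ x : ℂ) * (Complex.exp (E x) - 1) + ((χ x : ℂ) - 1) := by ring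
    rw [hsplit]
    refine (norm_add_le _ _).trans ?_
    have h2 : ‖(χ x : ℂ) - 1‖ = 1 - χ x := by
      rw [← Complex.ofReal_one, ← Complex.ofReal_sub, Complex.norm_real, Real.norm_eq_abs, abs_sub_comm,
        abs_of_nonneg (by linarith [(hχ x).2])]
    rw [h2, norm_mul, Complex.norm_real, Real.norm_eq_abs, abs_of_nonneg (hχ x).1]
    by_cases h0 : χ x = 0
    · rw [h0, zero_mul]
      linarith
    · have := hE x h0
      nlinarith [(hχ x).1, (hχ x).2, norm_nonneg (Complex.exp (E x) - 1)]
  have hbound_int : Integrable (fun x : ι → ℝ => η₁ * Real.exp (-(1 / 2 : ℝ) * quadFormR (M.map Complex.re) x)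
      + (1 - χ x) * Real.exp (-(1 / 2 : ℝ) * quadFormR (M.map Complex.re) x)) := by
    have hint : Integrable (fun x : ι → ℝ => Real.exp (-(1 / 2 : ℝ) * quadFormR (M.map Complex.re) x)) :=
      hden_int.norm.congr (Filter.Eventually.of_forall fun x => norm_gaussNormIntegrand M x)
    exact (hint.const_mul _).add htail_int
  calc ‖∫ x : ι → ℝ, ((χ x : ℂ) * Complex.exp (E x) - 1) * Complex.exp (-(1 / 2 : ℂ) * quadC M x)‖
      ≤ ∫ x : ι → ℝ, (η₁ * Real.exp (-(1 / 2 : ℝ) * quadFormR (M.map Complex.re) x)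
          + (1 - χ x) * Real.exp (-(1 / 2 : ℝ) * quadFormR (M.map Complex.re) x)) :=
        norm_integral_le_of_norm_le hbound_int (Filter.Eventually.of_forall hpt)
    _ = η₁ * gaussNormR (M.map Complex.re)
          + ∫ x : ι → ℝ, (1 - χ x) * Real.exp (-(1 / 2 : ℝ) * quadFormR (M.map Complex.re) x) := by
        rw [integral_add ((hbound_int.sub htail_int).congr ?_) htail_int, integral_const_mul]
        · rfl
        · exact Filter.Eventually.of_forall fun x => by simp
    _ ≤ η₁ * gaussNormR (M.map Complex.re) + T * gaussNormR (M.map Complex.re) := by linarith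
    _ = Real.exp τ * (η₁ + T) * (Real.exp (-τ) * gaussNormR (M.map Complex.re)) := by
        have : Real.exp τ * Real.exp (-τ) = 1 := by rw [← Real.exp_add, add_neg_cancel, Real.exp_zero]
        linear_combination (-((η₁ + T) * gaussNormR (M.map Complex.re))) * this
    _ ≤ Real.exp τ * (η₁ + T) * ‖gaussNormC M‖ :=
        mul_le_mul_of_nonneg_left hden (mul_nonneg (Real.exp_pos _).le (add_nonneg hη₁ hT))

end Summit.QuantumFields.YangMills.Theorems.K0AxComplexGaussianRatio

end
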